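/-
Copyright: derived here (Resolution Observatory cell `pub-rosobs`, carver gen 52; v2 = v1 (p379844) + the (NoSupplier) ⇒ (NS) packaging).
INSTRUMENT, NOT a resolution theorem.  Context-only citations; statement-level typing of an identity core used by the cell's
engine-1 model notes (THEOREM-FS / CARVER-NOTES eng1-g35, ask **T25**).  AI-written; AI review is weaker than expert review.
-/
import Mathlib.Algebra.MvPolynomial.PDeriv
import Mathlib.Algebra.MvPolynomial.CommRing
import Mathlib.Data.Nat.Choose.Sum
import Mathlib.Data.Finsupp.Weight
import HarnessLib

/-!
# Heavy-monomial Taylor expansion of a layered substitution (T25 core, "extraction identity")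

Setting (the reduction of the cell's T25 to commutative algebra).  `S` is a commutative ring of "layer coefficients"
(in the application `S = R[σ]/(σ^{q+1})`), `B = MvPolynomial ι S`, and `φ : ι → B` describes a substitution
`X i ↦ φ i` (`MvPolynomial.aeval φ`).  A predicate `H : ι → Prop` singles out the HEAVY variables; a monomial
`t : ι →₀ ℕ` is heavy (`IsHeavy H t`) when all its variables are.  `killLight H : B →ₐ[S] B` sets the light variables
to `0`; it does not change the coefficient of a heavy monomial (`coeff_killLight_of_isHeavy`).

* **No-supplier reduction** (`coeff_aeval_eq_coeff_aeval_heavyShift`): if the heavy projection of every `φ i` is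
  `X i^H + C (p i)` with a SCALAR `p i : S` (`X i^H = X i` for heavy `i`, `0` for light `i`) — i.e. no impure layer term is
  supported on heavy variables — then for every heavy `t`, `coeff t (aeval φ G) = coeff t (aeval (heavyShift H p) G)`:
  only the pure scalar layers matter.
* **Shifted-monomial coefficient** (`coeff_aeval_heavyShift_monomial`): for heavy `t`,
  `coeff t (aeval (heavyShift H p) (monomial m s)) = if t ≤ m then s * m.prod (fun i k => k.choose (t i) * p i ^ (k - t i)) else 0`
  (the replacement pattern is `j = m − t`; the binomials count the replaced occurrences).
* **Heavy Taylor expansion** (`coeff_aeval_heavyShift`, `coeff_aeval_heavyShift_eq_taylor`): summing over the support of `G`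
  and splitting off the patterns of degree `0` and `1`:
  `coeff t (aeval (heavyShift H p) G) = coeff t G + Σ_i (t i + 1) • p i * coeff (t + single i 1) G + R₂`,
  where `R₂` collects the patterns `m − t` of degree `≥ 2`; `coeff_pderiv_eq` identifies the middle term with
  `coeff t (Σ_i C (p i) * pderiv i G)`.  Under the cell's hypothesis (NC) (`R₂`'s terms vanish) this is the
  extraction identity `coeff t (Ψ G) = coeff t G + coeff t (Y G)`, `Y = Σ_i p i • ∂_i` (`coeff_aeval_eq_of_noCollision`);
  `coeff_aeval_X_add_eq_of_noSupplier` is the same with (NS) derived from the cell's support condition (NoSupplier):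
  every impure term of `Δ i = Ψ (X i) − X i` contains a light variable (`killLight_X_add_eq_heavyShift`).
  Sanity instances (scratch, not in this file): zero layers give `coeff t G = coeff t G`; the pattern `j = e₀ + e₁` on
  `m = 2e₀ + e₁`, `p = (3, 5)`, `t = e₀` has weight `choose 2 1 · 3 · choose 1 0 · 5 = 30`.

All statements are exact identities over an arbitrary commutative ring `S` (no division: the binomials are the Hasse form),
so they apply in characteristic `p` with `q = p`, which is the cell's case of interest.

References are CONTEXT ONLY: [AbramovichTemkinWlodarczyk2024, §5.1] for weighted centres / layered coordinate changes,
[Abhyankar1990, p. 190] for the binomial theorem as the source of (Hasse) differential calculus in resolution; every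
declaration here is "derived here" (the cell's own bookkeeping), none is a published theorem.
-/

namespace Literature.AlgebraicGeometry.Resolution.WeightedBlowup

open MvPolynomial Finset Finsupp

open scoped BigOperators

section Heavy

variable {S : Type*} [CommRing S] {ι : Type*} (H : ι → Prop) [DecidablePred H]

/-- A monomial (exponent vector) is heavy when every variable occurring in it is heavy (derived here).
[cite: AbramovichTemkinWlodarczyk2024, §5.1 (p. 1575)] -/
def IsHeavy (t : ι →₀ ℕ) : Prop := ∀ i ∈ t.support, H i

/-- Heaviness of a monomial is decidable (plumbing instance; derived here). [cite: AbramovichTemkinWlodarczyk2024, §5.1 (p. 1575)] -/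
instance IsHeavy.decidable (t : ι →₀ ℕ) : Decidable (IsHeavy H t) := by
  unfold IsHeavy; infer_instance

omit [DecidablePred H] in
/-- Heaviness is inherited by smaller exponent vectors (derived here). [cite: AbramovichTemkinWlodarczyk2024, §5.1 (p. 1575)] -/
theorem IsHeavy.mono {t t' : ι →₀ ℕ} (ht : IsHeavy H t) (h : t' ≤ t) : IsHeavy H t' := by
  intro i hi
  refine ht i ?_
  rw [Finsupp.mem_support_iff] at hi ⊢
  exact fun h0 => hi (Nat.eq_zero_of_le_zero (h0 ▸ h i))

omit [DecidablePred H] in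
/-- A heavy monomial has exponent `0` at every light variable (derived here). [cite: AbramovichTemkinWlodarczyk2024, §5.1 (p. 1575)] -/
theorem IsHeavy.apply_eq_zero {t : ι →₀ ℕ} (ht : IsHeavy H t) {i : ι} (hi : ¬ H i) : t i = 0 := by
  by_contra h
  exact hi (ht i (Finsupp.mem_support_iff.mpr h))

/-- The heavy generator: `X i` for a heavy variable, `0` for a light one (derived here).
[cite: AbramovichTemkinWlodarczyk2024, §5.1 (p. 1575)] -/
noncomputable def heavyX (i : ι) : MvPolynomial ι S := if H i then X i else 0

/-- `killLight H` : the `S`-algebra endomorphism of `MvPolynomial ι S` killing the light variables (derived here).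
[cite: AbramovichTemkinWlodarczyk2024, §5.1 (p. 1575)] -/
noncomputable def killLight : MvPolynomial ι S →ₐ[S] MvPolynomial ι S := aeval (heavyX (S := S) H)

/-- `killLight` on a generator (derived here; bookkeeping). [cite: AbramovichTemkinWlodarczyk2024, §5.1 (p. 1575)] -/
@[simp] theorem killLight_X (i : ι) : killLight (S := S) H (X i) = heavyX H i := by
  simp [killLight]

/-- `killLight` fixes heavy monomials and kills the others (derived here). [cite: AbramovichTemkinWlodarczyk2024, §5.1 (p. 1575)] -/
theorem killLight_monomial (m : ι →₀ ℕ) (s : S) :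
    killLight H (monomial m s) = if IsHeavy H m then monomial m s else 0 := by
  classical
  rw [killLight, aeval_monomial, MvPolynomial.algebraMap_eq]
  by_cases hm : IsHeavy H m
  · rw [if_pos hm, MvPolynomial.monomial_eq]
    congr 1
    refine Finsupp.prod_congr fun i hi => ?_
    simp [heavyX, hm i hi]
  · rw [if_neg hm]
    obtain ⟨i, hi, hHi⟩ : ∃ i ∈ m.support, ¬ H i := by
      by_contra h
      push Not at h
      exact hm h
    rw [Finsupp.prod, Finset.prod_eq_zero hi (by simp [heavyX, hHi, Finsupp.mem_support_iff.mp hi]), mul_zero]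

/-- Coefficients of `killLight G`: the heavy ones are those of `G`, the others vanish (derived here).
[cite: AbramovichTemkinWlodarczyk2024, §5.1 (p. 1575)] -/
theorem coeff_killLight (G : MvPolynomial ι S) (t : ι →₀ ℕ) :
    coeff t (killLight H G) = if IsHeavy H t then coeff t G else 0 := by
  classical
  conv_lhs => rw [G.as_sum, map_sum, coeff_sum]
  simp_rw [killLight_monomial]
  split_ifs with ht
  · conv_rhs => rw [G.as_sum, coeff_sum]
    refine Finset.sum_congr rfl fun m _ => ?_
    by_cases hm : IsHeavy H m
    · rw [if_pos hm]
    · rw [if_neg hm, coeff_zero, coeff_monomial, if_neg]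
      rintro rfl
      exact hm ht
  · refine Finset.sum_eq_zero fun m _ => ?_
    by_cases hm : IsHeavy H m
    · rw [if_pos hm, coeff_monomial, if_neg]
      rintro rfl
      exact ht hm
    · rw [if_neg hm, coeff_zero]

/-- `killLight` does not change the coefficient of a heavy monomial (derived here). [cite: AbramovichTemkinWlodarczyk2024, §5.1 (p. 1575)] -/
theorem coeff_killLight_of_isHeavy {t : ι →₀ ℕ} (ht : IsHeavy H t) (G : MvPolynomial ι S) :
    coeff t (killLight H G) = coeff t G := by
  rw [coeff_killLight, if_pos ht]

/-- The pure shifted substitution `X i ↦ X i^H + C (p i)` with scalar layers `p i : S` (derived here).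
[cite: AbramovichTemkinWlodarczyk2024, §5.1 (p. 1575)] -/
noncomputable def heavyShift (p : ι → S) (i : ι) : MvPolynomial ι S := heavyX H i + C (p i)

/-- **No-supplier reduction** (derived here).  If the heavy projection of every `φ i` is the pure scalar shift
`X i^H + C (p i)` (no impure layer term supported on heavy variables), then at every heavy monomial the substitution
`aeval φ` agrees with the pure substitution `aeval (heavyShift H p)`. [cite: AbramovichTemkinWlodarczyk2024, §5.1 (p. 1575)] -/
theorem coeff_aeval_eq_coeff_aeval_heavyShift (φ : ι → MvPolynomial ι S) (p : ι → S)
    (hNS : ∀ i, killLight H (φ i) = heavyShift H p i) {t : ι →₀ ℕ} (ht : IsHeavy H t) (G : MvPolynomial ι S) :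
    coeff t (aeval φ G) = coeff t (aeval (heavyShift H p) G) := by
  rw [← coeff_killLight_of_isHeavy H ht (aeval φ G), ← AlgHom.comp_apply, comp_aeval,
    show (fun i => killLight H (φ i)) = heavyShift H p from funext hNS]

end Heavy

section Shift

variable {S : Type*} [CommRing S] {ι : Type*} (H : ι → Prop) [DecidablePred H]

/-- Coefficient of `X a ^ l * G` (derived here; bookkeeping). [cite: AbramovichTemkinWlodarczyk2024, §5.1 (p. 1575)] -/
theorem coeff_X_pow_mul_eq_ite [DecidableEq ι] (a : ι) (l : ℕ) (t : ι →₀ ℕ) (G : MvPolynomial ι S) :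
    coeff t (X a ^ l * G) = if l ≤ t a then coeff (t - single a l) G else 0 := by
  rw [X_pow_eq_monomial, coeff_monomial_mul', one_mul]
  simp only [Finsupp.single_le_iff]

/-- The binomial weight of the replacement pattern `m − t` at one variable: `choose k (t i) · p i ^ (k − t i)`
(derived here). [cite: AbramovichTemkinWlodarczyk2024, §5.1 (p. 1575)] -/
def shiftWeight (p : ι → S) (t : ι →₀ ℕ) (i : ι) (k : ℕ) : S := (k.choose (t i) : S) * p i ^ (k - t i)

omit [DecidablePred H] in
/-- An unreplaced variable has weight `1` (derived here; bookkeeping). [cite: AbramovichTemkinWlodarczyk2024, §5.1 (p. 1575)] -/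
@[simp] theorem shiftWeight_self (p : ι → S) (t : ι →₀ ℕ) (i : ι) : shiftWeight p t i (t i) = 1 := by
  simp [shiftWeight]

/-- **Shifted-monomial coefficient** (derived here).  For a heavy `t`, the coefficient of `X^t` in
`(X^H + C p)^m = Π_i (X i^H + C (p i))^{m i}` is `Π_{i ∈ supp m} choose (m i) (t i) · p i^{m i − t i}` if `t ≤ m`
(replacement pattern `m − t`), and `0` otherwise — the multivariate binomial theorem read coefficientwise.
[cite: Abhyankar1990, p. 190] -/
theorem coeff_aeval_heavyShift_monomial (p : ι → S) (m : ι →₀ ℕ) (s : S) {t : ι →₀ ℕ} (ht : IsHeavy H t) :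
    coeff t (aeval (heavyShift H p) (monomial m s)) =
      if t ≤ m then s * m.prod (shiftWeight p t) else 0 := by
  classical
  induction m using Finsupp.induction generalizing t with
  | zero =>
    simp only [monomial_zero', aeval_C, MvPolynomial.algebraMap_eq, coeff_C, le_zero_iff, Finsupp.prod_zero_index,
      mul_one]
    by_cases h : t = 0
    · simp [h]
    · rw [if_neg (Ne.symm h), if_neg h]
  | single_add a b f ha hb ih =>
    rw [monomial_single_add, map_mul, map_pow, aeval_X]
    have hfa : f a = 0 := Finsupp.notMem_support_iff.mp ha
    -- the value of the `f`-part at `t - single a l` only depends on `t` off `a`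
    have hprod : ∀ l, f.prod (shiftWeight p (t - single a l)) = f.prod (shiftWeight p t) := by
      intro l
      refine Finsupp.prod_congr fun i hi => ?_
      have hia : i ≠ a := by rintro rfl; exact ha hi
      simp only [shiftWeight, Finsupp.tsub_apply, Finsupp.single_eq_of_ne hia, Nat.sub_zero]
    -- the condition `t ≤ single a b + f`
    have hle : t ≤ single a b + f ↔ t a ≤ b ∧ t - single a (t a) ≤ f := by
      simp only [Finsupp.le_def, Finsupp.add_apply, Finsupp.tsub_apply]
      constructor
      · intro h
        refine ⟨by simpa [hfa] using h a, fun i => ?_⟩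
        by_cases hia : i = a
        · subst hia; simp
        · have := h i
          rw [Finsupp.single_eq_of_ne hia, zero_add] at this
          rw [Finsupp.single_eq_of_ne hia, Nat.sub_zero]
          exact this
      · rintro ⟨h1, h2⟩ i
        by_cases hia : i = a
        · subst hia; simp [hfa, h1]
        · have := h2 i
          rw [Finsupp.single_eq_of_ne hia, Nat.sub_zero] at this
          rw [Finsupp.single_eq_of_ne hia, zero_add]
          exact this
    have hsplit : (single a b + f).prod (shiftWeight p t) = shiftWeight p t a b * f.prod (shiftWeight p t) := by
      rw [Finsupp.prod_add_index_of_disjoint]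
      · congr 1
        rw [Finsupp.prod, Finsupp.support_single _ hb, Finset.prod_singleton, Finsupp.single_eq_same]
      · rw [Finsupp.support_single _ hb, Finset.disjoint_singleton_left]
        exact ha
    by_cases hHa : H a
    · -- heavy variable: binomial expansion of `(X a + C (p a)) ^ b`
      have hX : heavyShift H p a = X a + C (p a) := by simp [heavyShift, heavyX, hHa]
      rw [hX, add_pow, Finset.sum_mul, coeff_sum]
      have hterm : ∀ l ∈ range (b + 1),
          coeff t (X a ^ l * C (p a) ^ (b - l) * (b.choose l : MvPolynomial ι S) *
              aeval (heavyShift H p) (monomial f s)) =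
            if l = t a then (b.choose l : S) * p a ^ (b - l) *
              (if t - single a (t a) ≤ f then s * f.prod (shiftWeight p t) else 0) else 0 := by
        intro l _
        rw [show X a ^ l * C (p a) ^ (b - l) * (b.choose l : MvPolynomial ι S) * aeval (heavyShift H p) (monomial f s)
            = X a ^ l * (C ((b.choose l : S) * p a ^ (b - l)) * aeval (heavyShift H p) (monomial f s)) by
            rw [map_mul, map_pow, map_natCast]; ring,
          coeff_X_pow_mul_eq_ite, coeff_C_mul, ih (ht.mono H tsub_le_self), hprod]
        by_cases hl : l = t a
        · subst hl; simp
        · rw [if_neg hl]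
          by_cases h1 : l ≤ t a
          · rw [if_pos h1]
            have h2 : ¬ t - single a l ≤ f := by
              intro h2
              have := h2 a
              rw [Finsupp.tsub_apply, Finsupp.single_eq_same, hfa, Nat.le_zero, Nat.sub_eq_zero_iff_le] at this
              exact hl (le_antisymm h1 this)
            rw [if_neg h2, mul_zero]
          · rw [if_neg h1]
      rw [Finset.sum_congr rfl hterm, Finset.sum_ite_eq' (range (b + 1)) (t a)]
      simp only [Finset.mem_range, Nat.lt_succ_iff, hle, hsplit]
      by_cases h1 : t a ≤ b
      · by_cases h2 : t - single a (t a) ≤ f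
        · simp only [h1, h2, if_true, and_self, shiftWeight]
          ring
        · simp [h1, h2]
      · simp [h1]
    · -- light variable: `t a = 0` and the factor is the constant `C (p a) ^ b`
      have hX : heavyShift H p a = C (p a) := by simp [heavyShift, heavyX, hHa]
      have hta : t a = 0 := ht.apply_eq_zero H hHa
      have ht0 : t - single a (t a) = t := by rw [hta, Finsupp.single_zero, tsub_zero]
      rw [hX, ← map_pow, coeff_C_mul, ih ht]
      rw [ht0, hta] at hle
      simp only [zero_le, true_and] at hle
      simp only [hle, hsplit, shiftWeight, hta, Nat.choose_zero_right, Nat.cast_one, one_mul, Nat.sub_zero]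
      split_ifs <;> ring

end Shift

section Taylor

variable {S : Type*} [CommRing S] {ι : Type*} (H : ι → Prop) [DecidablePred H]

omit [DecidablePred H] in
/-- The trivial pattern has weight `1` (derived here; bookkeeping). [cite: AbramovichTemkinWlodarczyk2024, §5.1 (p. 1575)] -/
theorem prod_shiftWeight_self (p : ι → S) (t : ι →₀ ℕ) : t.prod (shiftWeight p t) = 1 :=
  Finset.prod_eq_one fun i _ => shiftWeight_self p t i

omit [DecidablePred H] in
/-- A first-order pattern `single i 1` has weight `(t i + 1) · p i` — the coefficient of `X^t` in `p i • ∂_i X^{t + e_i}`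
(derived here). [cite: AbramovichTemkinWlodarczyk2024, §5.1 (p. 1575)] -/
theorem prod_shiftWeight_add_single [DecidableEq ι] (p : ι → S) (t : ι →₀ ℕ) (i : ι) :
    (t + single i 1).prod (shiftWeight p t) = ((t i + 1 : ℕ) : S) * p i := by
  rw [Finsupp.prod, Finset.prod_eq_single i]
  · simp [shiftWeight, Nat.choose_succ_self_right]
  · intro j _ hji
    simp [shiftWeight, Finsupp.single_eq_of_ne hji]
  · intro hi
    exfalso
    exact hi (Finsupp.mem_support_iff.mpr (by simp))

/-- **Heavy expansion over the support** (derived here): for a heavy `t`,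
`coeff t ((X^H + C p)^G) = Σ_{m ∈ supp G, t ≤ m} G_m · Π_{i ∈ supp m} choose (m i) (t i) p i^{m i − t i}`.
[cite: AbramovichTemkinWlodarczyk2024, §5.1 (p. 1575)] -/
theorem coeff_aeval_heavyShift (p : ι → S) (G : MvPolynomial ι S) {t : ι →₀ ℕ} (ht : IsHeavy H t) :
    coeff t (aeval (heavyShift H p) G) =
      ∑ m ∈ G.support, if t ≤ m then coeff m G * m.prod (shiftWeight p t) else 0 := by
  classical
  conv_lhs => rw [G.as_sum, map_sum, coeff_sum]
  exact Finset.sum_congr rfl fun m _ => coeff_aeval_heavyShift_monomial H p m _ ht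

/-- **Heavy Taylor expansion, split by the degree of the replacement pattern** (derived here): for a heavy `t`,
`coeff t ((X^H + C p)^G) = coeff t G + (patterns of degree 1) + (patterns of degree ≥ 2)` (Hasse–Taylor form, no division).
[cite: Abhyankar1990, p. 190] -/
theorem coeff_aeval_heavyShift_eq_taylor (p : ι → S) (G : MvPolynomial ι S) {t : ι →₀ ℕ} (ht : IsHeavy H t) :
    coeff t (aeval (heavyShift H p) G) = coeff t G
      + (∑ m ∈ G.support, if t ≤ m ∧ (m - t).degree = 1 then coeff m G * m.prod (shiftWeight p t) else 0)
      + (∑ m ∈ G.support, if t ≤ m ∧ 2 ≤ (m - t).degree then coeff m G * m.prod (shiftWeight p t) else 0) := by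
  classical
  rw [coeff_aeval_heavyShift H p G ht]
  have hdeg0 : ∀ m : ι →₀ ℕ, (t ≤ m ∧ (m - t).degree = 0) ↔ m = t := by
    intro m
    rw [Finsupp.degree_eq_zero_iff, tsub_eq_zero_iff_le]
    constructor
    · rintro ⟨h1, h2⟩; exact le_antisymm h2 h1
    · rintro rfl; exact ⟨le_rfl, le_rfl⟩
  have h0 : coeff t G =
      ∑ m ∈ G.support, if t ≤ m ∧ (m - t).degree = 0 then coeff m G * m.prod (shiftWeight p t) else 0 := by
    simp_rw [hdeg0]
    rw [Finset.sum_ite_eq']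
    split_ifs with h
    · rw [prod_shiftWeight_self, mul_one]
    · exact MvPolynomial.notMem_support_iff.mp h
  rw [h0, ← Finset.sum_add_distrib, ← Finset.sum_add_distrib]
  refine Finset.sum_congr rfl fun m _ => ?_
  by_cases htm : t ≤ m
  · obtain h | h | h : (m - t).degree = 0 ∨ (m - t).degree = 1 ∨ 2 ≤ (m - t).degree := by omega
    · simp [htm, h]
    · simp [htm, h]
    · have h1 : (m - t).degree ≠ 0 := by omega
      have h2 : (m - t).degree ≠ 1 := by omega
      simp [htm, h, h1, h2]
  · simp [htm]

omit [DecidablePred H] in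
/-- The degree-one patterns are the first-order Taylor term `Σ_i (t i + 1) p i · G_{t + e_i}` (derived here).
[cite: AbramovichTemkinWlodarczyk2024, §5.1 (p. 1575)] -/
theorem sum_degree_one_pattern_eq [Fintype ι] [DecidableEq ι] (p : ι → S) (G : MvPolynomial ι S) (t : ι →₀ ℕ) :
    (∑ m ∈ G.support, if t ≤ m ∧ (m - t).degree = 1 then coeff m G * m.prod (shiftWeight p t) else 0) =
      ∑ i, ((t i + 1 : ℕ) : S) * p i * coeff (t + single i 1) G := by
  have hc : ∀ i, coeff (t + single i 1) G = ∑ m ∈ G.support, if m = t + single i 1 then coeff m G else 0 := by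
    intro i
    rw [Finset.sum_ite_eq']
    split_ifs with h
    · rfl
    · exact MvPolynomial.notMem_support_iff.mp h
  simp_rw [hc, Finset.mul_sum]
  rw [Finset.sum_comm]
  refine Finset.sum_congr rfl fun m _ => ?_
  by_cases h : t ≤ m ∧ (m - t).degree = 1
  · obtain ⟨i₀, hi₀⟩ : ∃ i, single i 1 = m - t :=
      (Set.ext_iff.mp (Finsupp.range_single_one (σ := ι)) (m - t)).mpr h.2
    have hm : m = t + single i₀ 1 := by rw [hi₀, add_tsub_cancel_of_le h.1]
    rw [if_pos h]
    subst hm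
    rw [prod_shiftWeight_add_single]
    have key : ∀ i, (t + single i₀ 1 = t + single i 1) ↔ i₀ = i := by
      intro i
      rw [add_right_inj, Finsupp.single_left_inj one_ne_zero]
    simp_rw [key, mul_ite, mul_zero]
    rw [Finset.sum_ite_eq, if_pos (Finset.mem_univ _)]
    ring
  · rw [if_neg h]
    symm
    refine Finset.sum_eq_zero fun i _ => ?_
    rw [if_neg, mul_zero]
    rintro rfl
    exact h ⟨le_self_add, by rw [add_tsub_cancel_left, Finsupp.degree_single]⟩

omit [DecidablePred H] in
/-- Coefficients of a partial derivative: `coeff t (∂_i G) = (t i + 1) · G_{t + e_i}` (derived here; bookkeeping).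
[cite: AbramovichTemkinWlodarczyk2024, §5.1 (p. 1575)] -/
theorem coeff_pderiv_eq [DecidableEq ι] (i : ι) (G : MvPolynomial ι S) (t : ι →₀ ℕ) :
    coeff t (pderiv i G) = ((t i + 1 : ℕ) : S) * coeff (t + single i 1) G := by
  induction G using MvPolynomial.induction_on' with
  | monomial m c =>
    rw [pderiv_monomial, coeff_monomial, coeff_monomial]
    by_cases hm : m = t + single i 1
    · subst hm
      rw [if_pos (add_tsub_cancel_right _ _), if_pos rfl, Finsupp.add_apply, Finsupp.single_eq_same]
      push_cast
      ring
    · rw [if_neg hm, mul_zero]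
      split_ifs with h
      · have hmi : m i = 0 := by
          by_contra hne
          apply hm
          rw [← h, tsub_add_cancel_of_le (Finsupp.single_le_iff.mpr (Nat.one_le_iff_ne_zero.mpr hne))]
        simp [hmi]
      · rfl
  | add p q hp hq => rw [map_add, coeff_add, coeff_add, hp, hq, mul_add]

/-- The first-order term as a differential operator: `Σ_i (t i + 1) p i G_{t+e_i} = coeff t (Σ_i p i • ∂_i G)`
(derived here). [cite: AbramovichTemkinWlodarczyk2024, §5.1 (p. 1575)] -/
theorem sum_first_order_eq_coeff_sum_pderiv [Fintype ι] [DecidableEq ι] (p : ι → S) (G : MvPolynomial ι S)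
    (t : ι →₀ ℕ) :
    ∑ i, ((t i + 1 : ℕ) : S) * p i * coeff (t + single i 1) G = coeff t (∑ i, C (p i) * pderiv i G) := by
  rw [coeff_sum]
  refine Finset.sum_congr rfl fun i _ => ?_
  rw [coeff_C_mul, coeff_pderiv_eq]
  ring

/-- **T25 core — the extraction identity** (derived here).  Let `φ` describe a substitution of `MvPolynomial ι S`
whose heavy projection is the pure scalar shift `X i ↦ X i^H + C (p i)` (hypothesis (NS): no impure layer term is
supported on heavy variables), and let `t` be a heavy monomial such that (NC) every monomial `m = t + j` of `G` with a
replacement pattern `j` of degree `≥ 2` and non-zero binomial weight has `G_m · weight = 0`.  Then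
`coeff t (aeval φ G) = coeff t G + coeff t (Σ_i p i • ∂_i G)`.
In the cell's application `S = R[σ]/(σ^{q+1})`, `G` is `σ`-free and one reads off the `σ^q`-component:
`coeff (σ^q t) (Ψ G) = coeff t (Y G)`, `Y = Σ_i [σ^q](p i) • ∂_i`. [cite: AbramovichTemkinWlodarczyk2024, §5.1 (p. 1575)] -/
theorem coeff_aeval_eq_of_noCollision [Fintype ι] [DecidableEq ι] (φ : ι → MvPolynomial ι S) (p : ι → S)
    (hNS : ∀ i, killLight H (φ i) = heavyShift H p i) (G : MvPolynomial ι S) {t : ι →₀ ℕ} (ht : IsHeavy H t)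
    (hNC : ∀ m ∈ G.support, t ≤ m → 2 ≤ (m - t).degree → coeff m G * m.prod (shiftWeight p t) = 0) :
    coeff t (aeval φ G) = coeff t G + coeff t (∑ i, C (p i) * pderiv i G) := by
  have hR : (∑ m ∈ G.support, if t ≤ m ∧ 2 ≤ (m - t).degree then coeff m G * m.prod (shiftWeight p t) else 0) = 0 := by
    refine Finset.sum_eq_zero fun m hm => ?_
    split_ifs with h
    · exact hNC m hm h.1 h.2
    · rfl
  rw [coeff_aeval_eq_coeff_aeval_heavyShift H φ p hNS ht, coeff_aeval_heavyShift_eq_taylor H p G ht,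
    sum_degree_one_pattern_eq, sum_first_order_eq_coeff_sum_pderiv, hR, add_zero]

end Taylor

section NoSupplier

variable {S : Type*} [CommRing S] {ι : Type*} (H : ι → Prop) [DecidablePred H]

/-- If every non-constant monomial of `F` contains a light variable, the heavy projection of `F` is its constant term
(derived here). [cite: AbramovichTemkinWlodarczyk2024, §5.1 (p. 1575)] -/
theorem killLight_eq_C_coeff_zero (F : MvPolynomial ι S) (h : ∀ κ ∈ F.support, κ ≠ 0 → ¬ IsHeavy H κ) :
    killLight H F = C (coeff 0 F) := by
  classical
  refine MvPolynomial.ext _ _ fun t => ?_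
  rw [coeff_killLight, coeff_C]
  by_cases ht : IsHeavy H t
  · rw [if_pos ht]
    by_cases h0 : (0 : ι →₀ ℕ) = t
    · subst h0; simp
    · rw [if_neg h0]
      by_contra hne
      exact h t (MvPolynomial.mem_support_iff.mpr hne) (Ne.symm h0) ht
  · rw [if_neg ht, if_neg]
    rintro rfl
    exact ht fun i hi => by simp at hi

/-- **(NoSupplier) ⇒ (NS)** (derived here).  In the cell's phrasing: if `Ψ (X i) = X i + Δ i` and every impure term of every
`Δ i` (every monomial `κ ≠ 0` of `Δ i`) contains a light variable, then the heavy projection of `Ψ (X i)` is the pure scalar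
shift with `p i = coeff 0 (Δ i)` (the pure part), i.e. hypothesis `hNS` of `coeff_aeval_eq_of_noCollision`.
[cite: AbramovichTemkinWlodarczyk2024, §5.1 (p. 1575)] -/
theorem killLight_X_add_eq_heavyShift (Δ : ι → MvPolynomial ι S)
    (h : ∀ i, ∀ κ ∈ (Δ i).support, κ ≠ 0 → ¬ IsHeavy H κ) (i : ι) :
    killLight H (X i + Δ i) = heavyShift H (fun j => coeff 0 (Δ j)) i := by
  rw [map_add, killLight_X, killLight_eq_C_coeff_zero H (Δ i) (h i), heavyShift]

/-- **T25 core, cell phrasing** (derived here): `Ψ (X i) = X i + Δ i` with (NoSupplier) every impure term of `Δ i` containing a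
light variable and (NC) as in `coeff_aeval_eq_of_noCollision` (pure parts `p i = coeff 0 (Δ i)`); then for every heavy `t`,
`coeff t (Ψ G) = coeff t G + coeff t (Σ_i (pure part of Δ i) • ∂_i G)`. [cite: AbramovichTemkinWlodarczyk2024, §5.1 (p. 1575)] -/
theorem coeff_aeval_X_add_eq_of_noSupplier [Fintype ι] [DecidableEq ι] (Δ : ι → MvPolynomial ι S)
    (hNoSup : ∀ i, ∀ κ ∈ (Δ i).support, κ ≠ 0 → ¬ IsHeavy H κ) (G : MvPolynomial ι S) {t : ι →₀ ℕ} (ht : IsHeavy H t)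
    (hNC : ∀ m ∈ G.support, t ≤ m → 2 ≤ (m - t).degree →
      coeff m G * m.prod (shiftWeight (fun j => coeff 0 (Δ j)) t) = 0) :
    coeff t (aeval (fun i => X i + Δ i) G) = coeff t G + coeff t (∑ i, C (coeff 0 (Δ i)) * pderiv i G) :=
  coeff_aeval_eq_of_noCollision H (fun i => X i + Δ i) (fun j => coeff 0 (Δ j))
    (killLight_X_add_eq_heavyShift H Δ hNoSup) G ht hNC

end NoSupplier

end Literature.AlgebraicGeometry.Resolution.WeightedBlowup
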